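import Literature.NumberTheory.EllipticCurves.BSDQuadraticDescentShaOddPartGeneralProofs
import Literature.NumberTheory.EllipticCurves.ShaPTorsionQuadraticSplitting
import Literature.Algebra.Module.AlternatingPairingParity
import Literature.NumberTheory.EllipticCurves.ShaFiniteProofs
import HarnessLib

/-!
# `Ш(E_K)[p^∞] ≅ Ш(E)[p^∞] × Ш(E^{(c)})[p^∞]` over a quadratic field `K = ℚ(√c)` for odd `p` — AS GROUPS and with
# NO finiteness hypothesis

Topic `NumberTheory/EllipticCurves`; theorems only (no definition, no named fact, no `sorry`, no instance). The tree's
`BSDQuadraticDescentShaOddPartGeneralProofs` proves `Φ(R_E × R_{E^{(c)}}) = R_{E_K}` (`map_comparisonMap_prod_ker_eq`) — `Φ`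
the comparison ISOMORPHISM `Sel_{p^∞}(E) × Sel_{p^∞}(E^{(c)}) ≅ Sel_{p^∞}(E_K)` of odd `p` (Dokchitser–Dokchitser 2010, Lemma
4.14), `R_X = ker (H¹(·, X[p^∞]) → H¹(·, X)) = X(F) ⊗ ℚ_p/ℤ_p` — ASSUMING `Ш(E)[p^∞]` and `Ш(E^{(c)})[p^∞]` finite, and deduces
the order identity for `Ш[p^∞]`. Here the finiteness hypothesis is REMOVED:

* `map_comparisonMap_prod_ker_eq_of_odd` — `Φ(R_E × R_{E^{(c)}}) = R_{E_K}` for every odd `p`, unconditionally. Proof: `⊆` as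
  in the tree; for `⊇`, the quotient `D = R_{E_K} / Φ(R_E × R_{E^{(c)}})` sits in the exact sequence
  `0 → D → Sel_{p^∞}(E_K)/Φ(R_E × R_{E^{(c)}}) → Ш(E_K)[p^∞] → 0` whose middle term is `≅ Ш(E)[p^∞] × Ш(E^{(c)})[p^∞]`;
  `D` is `p`-divisible (a quotient of `R_{E_K}`), so coranks add (`zpCorank_eq_add_of_exact`):
  `t_p(E) + t_p(E^{(c)}) = corank D + t_p(E_K)`. But `t_p(E_K) = t_p(E) + t_p(E^{(c)})` UNCONDITIONALLY (the corank
  identity, from Dokchitser's `rk_p` additivity and the Mordell–Weil ranks: tree `selmerCorank_baseChange_eq_add`,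
  `mordellWeilRank_baseChange_eq_add`, `selmerCorank_eq_mordellWeilRank_add_holds`), so `corank D = 0`, `D[p] = 0`, and a
  `p`-primary group without `p`-torsion is trivial: `D = 0`.
* `nonempty_addEquiv_primaryComponent_sha_prod_baseChange_of_odd` — **`Ш(E/ℚ)[p^∞] × Ш(E^{(c)}/ℚ)[p^∞] ≃+ Ш(E_K/K)[p^∞]`**
  for every odd prime `p` (Jetchev–Skinner–Wan 2017 §7.4.1 "`Ш(E/K)[p^∞] ≅ Ш(E/ℚ)[p^∞] ⊕ Ш(E^D/ℚ)[p^∞]`", there under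
  analytic rank one; here for every `E/ℚ`);
* `card_primaryComponent_sha_baseChange_quadratic_of_odd'` — `#Ш(E_K)[p^∞] = #Ш(E)[p^∞] · #Ш(E^{(c)})[p^∞]` (`Nat.card`) and
  the finiteness equivalence, with no hypothesis.

At `p = 2` nothing is claimed.

## References

* D. Jetchev, C. Skinner, X. Wan, The BSD formula for elliptic curves of analytic rank one, Camb. J. Math. 5 (2017),
  §7.4.1 (arXiv:1512.06894 p. 30). [JetchevSkinnerWan2017]
* T. Dokchitser, V. Dokchitser, On the BSD quotients modulo squares, Ann. of Math. 172 (2010), Lemma 4.14 (proof).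
  [DokchitserDokchitserAnnals2010]
* R. Greenberg, Iwasawa theory for elliptic curves, LNM 1716 (1999), §1–§2. [Greenberg1999LNM]
-/

noncomputable section

open scoped Classical AddSubgroup

namespace Literature.NumberTheory.EllipticCurves

open WeierstrassCurve Literature.NumberTheory.QuadraticFields Literature.Algebra.Module

/-! ## §0 Algebra -/

/-- A `p`-primary abelian group whose `p`-torsion is trivial is trivial. [folklore] -/
private theorem eq_zero_of_primary_of_torsionBy_subsingleton {D : Type*} [AddCommGroup D] {p : ℕ}
    (hD : ∀ d : D, ∃ n : ℕ, p ^ n • d = 0) (h1 : ∀ d : D, p • d = 0 → d = 0) (d : D) : d = 0 := by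
  obtain ⟨n, hn⟩ := hD d
  induction n generalizing d with
  | zero => simpa using hn
  | succ n ih =>
    apply ih
    apply h1
    rw [← mul_nsmul', ← pow_succ']
    exact hn

/-- The `p`-torsion of a product embeds in the product of the `p`-torsions: finiteness. [folklore] -/
private theorem finite_torsionBy_prod {A B : Type*} [AddCommGroup A] [AddCommGroup B] (n : ℕ)
    [Finite (A[(n : ℤ)])] [Finite (B[(n : ℤ)])] : Finite ((A × B)[(n : ℤ)]) := by
  refine Finite.of_injective (fun x : (A × B)[(n : ℤ)] ↦
    ((⟨x.1.1, ?_⟩ : A[(n : ℤ)]), (⟨x.1.2, ?_⟩ : B[(n : ℤ)]))) ?_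
  · exact AddSubgroup.torsionBy.nsmul_iff.mpr (congrArg Prod.fst (AddSubgroup.torsionBy.nsmul_iff.mp x.2))
  · exact AddSubgroup.torsionBy.nsmul_iff.mpr (congrArg Prod.snd (AddSubgroup.torsionBy.nsmul_iff.mp x.2))
  · intro x y hxy
    simp only [Prod.mk.injEq, Subtype.mk.injEq] at hxy
    exact Subtype.ext (Prod.ext hxy.1 hxy.2)

/-! ## §1 `Sel_{p^∞}(X) / R_X ≅ Ш(X)[p^∞]` -/

section Quot

variable {F : Type} [Field F] [NumberField F] (X : WeierstrassCurve F) [X.IsElliptic] (p : ℕ) [hp : Fact p.Prime]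

/-- **`Sel_{p^∞}(E/F) / R_E ≅ Ш(E/F)[p^∞]`** with `R_E = ker (H¹(F, E[p^∞]) → H¹(F, E))` viewed in the Selmer group: the
fundamental sequence `0 → E(F) ⊗ ℚ_p/ℤ_p → Sel_{p^∞}(E/F) → Ш(E/F)[p^∞] → 0` (Greenberg 1999 §2; tree
`map_primaryH1ToH1_selmerGroupPInfty`). Stated as `Nonempty` (no definition). [cite: Greenberg1999LNM, §2 pp. 62–63] -/
theorem nonempty_quotient_ker_addEquiv_primaryComponent_sha :
    Nonempty (selmerGroupPInfty X p ⧸ (X.primaryH1ToH1 p).ker.addSubgroupOf (selmerGroupPInfty X p) ≃+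
      AddCommGroup.primaryComponent X.sha p) := by
  set Sel := selmerGroupPInfty X p
  let f : Sel →+ X.galH1 := (X.primaryH1ToH1 p).comp Sel.subtype
  have hker : f.ker = (X.primaryH1ToH1 p).ker.addSubgroupOf Sel := by
    ext s
    rw [AddMonoidHom.mem_ker, AddSubgroup.mem_addSubgroupOf, AddMonoidHom.mem_ker]
    rfl
  have hrange : f.range = (AddCommGroup.primaryComponent X.sha p).map X.sha.subtype := by
    rw [← X.map_primaryH1ToH1_selmerGroupPInfty p X.zsmul_geomPoints_surjective_holds, AddMonoidHom.range_comp,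
      AddSubgroup.range_subtype]
  let e : f.range ≃+ AddCommGroup.primaryComponent X.sha p :=
    (AddEquiv.addSubgroupCongr hrange).trans
      (AddSubgroup.equivMapOfInjective (AddCommGroup.primaryComponent X.sha p) X.sha.subtype
        Subtype.val_injective).symm
  exact ⟨((QuotientAddGroup.quotientAddEquivOfEq hker).symm.trans (QuotientAddGroup.quotientKerEquivRange f)).trans e⟩

end Quot

/-! ## §2 `Φ(R_E × R_{E^{(c)}}) = R_{E_K}` for odd `p`, finiteness-free -/

section Comparison

variable (W : WeierstrassCurve ℚ) [W.IsElliptic] (K : Type) [Field K] [NumberField K] (h2 : Module.finrank ℚ K = 2)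
  {θ : K} {c : ℚ} (hθ : θ ∉ Set.range (algebraMap ℚ K)) (hc : θ ^ 2 = algebraMap ℚ K c)
  (p : ℕ) [hp : Fact p.Prime]

include h2 in
/-- **`Φ(R_E × R_{E^{(c)}}) = R_{E_K}` for every ODD prime `p`, with NO finiteness hypothesis** (see the module docstring for
the corank argument replacing the finiteness of the two `Ш[p^∞]` used by the tree's `map_comparisonMap_prod_ker_eq`).
[cite: JetchevSkinnerWan2017, §7.4.1 (arXiv:1512.06894 p. 30)] [cite: DokchitserDokchitserAnnals2010, Lemma 4.14 (proof)]
[cite: Greenberg1999LNM, §1 pp. 54–57] -/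
theorem map_comparisonMap_prod_ker_eq_of_odd (hp2 : p ≠ 2)
    [(W.quadraticTwist c).IsElliptic] [(W.baseChange K).IsElliptic] :
    (((W.primaryH1ToH1 p).ker.addSubgroupOf (selmerGroupPInfty W p)).prod
        (((W.quadraticTwist c).primaryH1ToH1 p).ker.addSubgroupOf
          (selmerGroupPInfty (W.quadraticTwist c) p))).map (comparisonMap W K hθ hc p) =
      ((W.baseChange K).primaryH1ToH1 p).ker.addSubgroupOf (selmerGroupPInfty (W.baseChange K) p) := by
  have hodd : Odd p := hp.out.odd_of_ne_two hp2
  have hbij := comparisonMap_bijective_of_odd W K h2 hθ hc p hodd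
  -- names
  set W' := W.quadraticTwist c with hW'
  set WK := W.baseChange K with hWK
  set S := selmerGroupPInfty W p
  set S' := selmerGroupPInfty W' p
  set SK := selmerGroupPInfty WK p
  set Φ := comparisonMap W K hθ hc p with hΦ
  set P : AddSubgroup (S × S') := ((W.primaryH1ToH1 p).ker.addSubgroupOf S).prod
    ((W'.primaryH1ToH1 p).ker.addSubgroupOf S') with hP
  set Q : AddSubgroup SK := (WK.primaryH1ToH1 p).ker.addSubgroupOf SK with hQ
  -- `⊆`: compatibility of `res` and `ψ_*` with `H¹(·, E[p^∞]) → H¹(·, E)` (as in the tree)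
  have hsub : P.map Φ ≤ Q := by
    intro s hs
    obtain ⟨x, hx, rfl⟩ := AddSubgroup.mem_map.mp hs
    rw [AddSubgroup.mem_prod, AddSubgroup.mem_addSubgroupOf, AddSubgroup.mem_addSubgroupOf,
      AddMonoidHom.mem_ker, AddMonoidHom.mem_ker] at hx
    rw [AddSubgroup.mem_addSubgroupOf, AddMonoidHom.mem_ker, coe_comparisonMap_apply, map_add,
      primaryH1ToH1_resPrimary, hx.1, map_zero, zero_add, ← AddMonoidHom.mem_ker,
      ← mem_ker_primaryH1ToH1_iff_hPsiK_mem, AddMonoidHom.mem_ker, primaryH1ToH1_resPrimary, hx.2,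
      map_zero]
  refine le_antisymm hsub ?_
  -- the quotients `M = SK / Φ(P)`, `C = SK / Q` and `g : M → C`
  set P' : AddSubgroup SK := P.map Φ with hP'
  have hPQ' : P' ≤ (QuotientAddGroup.mk' Q).ker := by rw [QuotientAddGroup.ker_mk']; exact hsub
  let g : SK ⧸ P' →+ SK ⧸ Q := QuotientAddGroup.lift P' (QuotientAddGroup.mk' Q) hPQ'
  have hg : ∀ s : SK, g (QuotientAddGroup.mk' P' s) = QuotientAddGroup.mk' Q s := fun s ↦
    QuotientAddGroup.lift_mk' P' hPQ' s
  have hgsurj : Function.Surjective g := by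
    intro y
    obtain ⟨s, rfl⟩ := QuotientAddGroup.mk'_surjective Q y
    exact ⟨QuotientAddGroup.mk' P' s, hg s⟩
  -- `D = Q / P'` inside `M`
  set D : AddSubgroup (SK ⧸ P') := Q.map (QuotientAddGroup.mk' P') with hD
  -- identifications `C ≃ Ш(E_K)[p^∞]` and `M ≃ Ш(E)[p^∞] × Ш(E')[p^∞]`
  obtain ⟨eK⟩ := nonempty_quotient_ker_addEquiv_primaryComponent_sha WK p
  obtain ⟨eQ⟩ := nonempty_quotient_ker_addEquiv_primaryComponent_sha W p
  obtain ⟨eT⟩ := nonempty_quotient_ker_addEquiv_primaryComponent_sha W' p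
  let eΦ : (S × S') ≃+ SK := AddEquiv.ofBijective Φ hbij
  have heΦ : P.map (eΦ : (S × S') →+ SK) = P' := by
    rw [hP']
    congr 1
  let eM : SK ⧸ P' ≃+ AddCommGroup.primaryComponent W.sha p × AddCommGroup.primaryComponent W'.sha p :=
    ((QuotientAddGroup.congr P P' eΦ heΦ).symm.trans (QuotientAddGroup.prodAddEquiv _ _)).trans
      (eQ.prodCongr eT)
  -- `p`-primary / finite `p`-torsion bookkeeping
  have hp0 : ((p : ℕ) : ℤ) ≠ 0 := by exact_mod_cast hp.out.ne_zero
  have hprimSha : ∀ (L : Type) [Field L] [NumberField L] (Y : WeierstrassCurve L)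
      (a : AddCommGroup.primaryComponent Y.sha p), ∃ k : ℕ, p ^ k • a = 0 := fun L _ _ Y a ↦ by
    obtain ⟨k, hk⟩ := (AddCommGroup.mem_primaryComponent).mp a.2
    exact ⟨k, Subtype.ext (by rw [AddSubgroupClass.coe_nsmul, hk, ZeroMemClass.coe_zero])⟩
  have hfinSha : ∀ (L : Type) [Field L] [NumberField L] (Y : WeierstrassCurve L) [Y.IsElliptic],
      Finite ((AddCommGroup.primaryComponent Y.sha p)[(p : ℤ)]) := fun L _ _ Y _ ↦ by
    haveI : Finite ((Y.sha)[(p : ℤ)]) := Y.finite_sha_torsionBy_holds (p : ℤ) hp0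
    exact Nat.finite_of_card_ne_zero (by rw [natCard_torsionBy_primaryComponent]; exact Nat.card_pos.ne')
  haveI := hfinSha ℚ W
  haveI := hfinSha ℚ W'
  haveI := hfinSha K WK
  -- `C`
  have hCprim : ∀ x : SK ⧸ Q, ∃ k : ℕ, p ^ k • x = 0 := fun x ↦ by
    obtain ⟨k, hk⟩ := hprimSha K WK (eK x)
    exact ⟨k, eK.injective (by rw [map_nsmul, hk, map_zero])⟩
  haveI : Finite ((SK ⧸ Q)[(p : ℤ)]) := Finite.of_equiv _ (torsionByEquiv eK p).symm.toEquiv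
  have hCcorank : zpCorank (SK ⧸ Q) p = WK.shaCorank p := by
    rw [zpCorank_congr eK p]; rfl
  -- `M`
  haveI : Finite ((AddCommGroup.primaryComponent W.sha p × AddCommGroup.primaryComponent W'.sha p)[(p : ℤ)]) :=
    finite_torsionBy_prod p
  haveI hMfin : Finite ((SK ⧸ P')[(p : ℤ)]) := Finite.of_equiv _ (torsionByEquiv eM p).symm.toEquiv
  have hMcorank : zpCorank (SK ⧸ P') p = W.shaCorank p + W'.shaCorank p := by
    rw [zpCorank_congr eM p, zpCorank_prod (hprimSha ℚ W) (hprimSha ℚ W')]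
    rfl
  -- `D` is `p`-divisible and `D[p]` is a finite `𝔽_p`-space
  have hDdiv : ∀ d : D, ∃ d' : D, p • d' = d := by
    rintro ⟨_, ⟨q, hq, rfl⟩⟩
    have hq' : (q : galH1Primary WK p) ∈ (WK.primaryH1ToH1 p).ker := (AddSubgroup.mem_addSubgroupOf).mp hq
    obtain ⟨z, hz, hzq⟩ := WK.exists_pow_nsmul_eq_of_mem_ker_primaryH1ToH1 p 1 hq'
    have hzS : z ∈ SK := WK.ker_primaryH1ToH1_le_selmerGroupPInfty p hz
    have hzq' : p • z = (q : galH1Primary WK p) := by rw [pow_one] at hzq; exact hzq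
    refine ⟨⟨QuotientAddGroup.mk' P' ⟨z, hzS⟩, ⟨⟨z, hzS⟩, (AddSubgroup.mem_addSubgroupOf).mpr hz, rfl⟩⟩,
      Subtype.ext ?_⟩
    change p • QuotientAddGroup.mk' P' ⟨z, hzS⟩ = QuotientAddGroup.mk' P' q
    rw [← map_nsmul]
    congr 1
    exact Subtype.ext (by rw [AddSubmonoidClass.coe_nsmul]; exact hzq')
  haveI : Finite (D[(p : ℤ)]) := by
    refine Finite.of_injective (fun x : D[(p : ℤ)] ↦ (⟨((x : D) : SK ⧸ P'), ?_⟩ : (SK ⧸ P')[(p : ℤ)])) ?_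
    · have h := AddSubgroup.torsionBy.nsmul_iff.mp x.2
      exact AddSubgroup.torsionBy.nsmul_iff.mpr (by
        rw [← AddSubgroupClass.coe_nsmul, h, ZeroMemClass.coe_zero])
    · intro x y hxy
      exact Subtype.ext (Subtype.ext (congrArg (fun z : (SK ⧸ P')[(p : ℤ)] ↦ (z : SK ⧸ P')) hxy))
  letI : Module (ZMod p) (D[(p : ℤ)]) := AddSubgroup.torsionBy.zmodModule
  set r := Module.finrank (ZMod p) (D[(p : ℤ)]) with hr
  have hDcard : Nat.card (D[(p : ℤ)]) = p ^ r := (pow_finrank_eq_natCard (p := p) (D[(p : ℤ)])).symm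
  -- corank additivity along `0 → D → M → C → 0`
  have key := zpCorank_eq_add_of_exact (p := p) (i := D.subtype) (f := g) (r := r) Subtype.val_injective hgsurj
    ?_ ?_ hDdiv hDcard hCprim
  rotate_left
  · -- exactness at `M`
    intro m hm
    obtain ⟨s, rfl⟩ := QuotientAddGroup.mk'_surjective P' m
    rw [hg] at hm
    have hm' : s ∈ Q := (QuotientAddGroup.eq_zero_iff s).mp hm
    exact ⟨⟨_, ⟨s, hm', rfl⟩⟩, rfl⟩
  · -- `g ∘ i = 0`
    rintro ⟨_, ⟨q, hq, rfl⟩⟩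
    change g (QuotientAddGroup.mk' P' q) = 0
    rw [hg]
    exact (QuotientAddGroup.eq_zero_iff q).mpr hq
  -- the corank identity forces `r = 0`
  have hcorank : WK.shaCorank p = W.shaCorank p + W'.shaCorank p := by
    have hS := selmerCorank_baseChange_eq_add W K h2 hθ hc p
    have hR := W.mordellWeilRank_baseChange_eq_add K h2 hθ hc
    rw [← hW', ← hWK] at hS hR
    have h1 := WK.selmerCorank_eq_mordellWeilRank_add_holds p
    have h2' := W.selmerCorank_eq_mordellWeilRank_add_holds p
    have h3 := W'.selmerCorank_eq_mordellWeilRank_add_holds p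
    omega
  have hr0 : r = 0 := by
    rw [hMcorank, hCcorank, hcorank] at key
    omega
  -- so `D[p] = 0`, hence `D = 0`
  have hD1 : ∀ d : D, p • d = 0 → d = 0 := by
    intro d hd
    haveI : Subsingleton (D[(p : ℤ)]) := by
      rw [hr0, pow_zero] at hDcard
      exact (Nat.card_eq_one_iff_unique.mp hDcard).1
    have : (⟨d, AddSubgroup.torsionBy.nsmul_iff.mpr hd⟩ : D[(p : ℤ)]) = 0 := Subsingleton.elim _ _
    exact congrArg Subtype.val this
  have hMprim : ∀ m : SK ⧸ P', ∃ k : ℕ, p ^ k • m = 0 := fun m ↦ by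
    obtain ⟨s, rfl⟩ := QuotientAddGroup.mk'_surjective P' m
    obtain ⟨k, hk⟩ := exists_pow_nsmul_eq_zero_galH1Primary WK p (s : galH1Primary WK p)
    refine ⟨k, ?_⟩
    have hs : p ^ k • s = 0 := Subtype.ext (by rw [AddSubmonoidClass.coe_nsmul, hk, ZeroMemClass.coe_zero])
    rw [← map_nsmul, hs, map_zero]
  have hDprim : ∀ d : D, ∃ n : ℕ, p ^ n • d = 0 := fun d ↦ by
    obtain ⟨k, hk⟩ := hMprim (d : SK ⧸ P')
    exact ⟨k, Subtype.ext (by rw [AddSubmonoidClass.coe_nsmul, hk, ZeroMemClass.coe_zero])⟩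
  have hD0 : ∀ d : D, d = 0 := eq_zero_of_primary_of_torsionBy_subsingleton hDprim hD1
  -- `Q ≤ P'`
  intro q hq
  have hmem : (⟨QuotientAddGroup.mk' P' q, ⟨q, hq, rfl⟩⟩ : D) = 0 := hD0 _
  have : QuotientAddGroup.mk' P' q = 0 := congrArg Subtype.val hmem
  exact (QuotientAddGroup.eq_zero_iff q).mp this


include h2 hθ hc in
/-- **`Ш(E/ℚ)[p^∞] × Ш(E^{(c)}/ℚ)[p^∞] ≃+ Ш(E_K/K)[p^∞]` for every ODD prime `p`, unconditionally** (`K = ℚ(θ)`,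
`θ² = c`): the comparison isomorphism `Φ` carries `R_E × R_{E^{(c)}}` onto `R_{E_K}` (`map_comparisonMap_prod_ker_eq_of_odd`),
so it descends to the quotients `Sel_{p^∞}/R = Ш[p^∞]`. Jetchev–Skinner–Wan 2017 §7.4.1 state this under analytic rank one;
here it holds for every elliptic curve over `ℚ`. Stated as `Nonempty` (no definition).
[cite: JetchevSkinnerWan2017, §7.4.1 (arXiv:1512.06894 p. 30)] [cite: DokchitserDokchitserAnnals2010, Lemma 4.14 (proof)] -/
theorem nonempty_addEquiv_primaryComponent_sha_prod_baseChange_of_odd (hp2 : p ≠ 2)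
    [(W.quadraticTwist c).IsElliptic] [(W.baseChange K).IsElliptic] :
    Nonempty (AddCommGroup.primaryComponent W.sha p × AddCommGroup.primaryComponent (W.quadraticTwist c).sha p ≃+
      AddCommGroup.primaryComponent (W.baseChange K).sha p) := by
  have hodd : Odd p := hp.out.odd_of_ne_two hp2
  have hbij := comparisonMap_bijective_of_odd W K h2 hθ hc p hodd
  set P : AddSubgroup (selmerGroupPInfty W p × selmerGroupPInfty (W.quadraticTwist c) p) :=
    ((W.primaryH1ToH1 p).ker.addSubgroupOf (selmerGroupPInfty W p)).prod
      (((W.quadraticTwist c).primaryH1ToH1 p).ker.addSubgroupOf (selmerGroupPInfty (W.quadraticTwist c) p)) with hP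
  set Q : AddSubgroup (selmerGroupPInfty (W.baseChange K) p) :=
    ((W.baseChange K).primaryH1ToH1 p).ker.addSubgroupOf (selmerGroupPInfty (W.baseChange K) p) with hQ
  have hPQ : P.map (comparisonMap W K hθ hc p) = Q := map_comparisonMap_prod_ker_eq_of_odd W K h2 hθ hc p hp2
  let eΦ : (selmerGroupPInfty W p × selmerGroupPInfty (W.quadraticTwist c) p) ≃+
      selmerGroupPInfty (W.baseChange K) p := AddEquiv.ofBijective _ hbij
  have heΦ : P.map (eΦ : _ →+ selmerGroupPInfty (W.baseChange K) p) = Q := by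
    rw [← hPQ]
    congr 1
  obtain ⟨eK⟩ := nonempty_quotient_ker_addEquiv_primaryComponent_sha (W.baseChange K) p
  obtain ⟨eQ⟩ := nonempty_quotient_ker_addEquiv_primaryComponent_sha W p
  obtain ⟨eT⟩ := nonempty_quotient_ker_addEquiv_primaryComponent_sha (W.quadraticTwist c) p
  exact ⟨(((eQ.prodCongr eT).symm.trans (QuotientAddGroup.prodAddEquiv _ _).symm).trans
    (QuotientAddGroup.congr P Q eΦ heΦ)).trans eK⟩

end Comparison

end Literature.NumberTheory.EllipticCurves

/-! ## §3 Orders and finiteness of `Ш[p^∞]` over a quadratic field, odd `p`, no hypothesis -/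

namespace WeierstrassCurve

open Literature.NumberTheory.EllipticCurves Literature.NumberTheory.QuadraticFields

section Orders

variable (W : WeierstrassCurve ℚ) [W.IsElliptic] (K : Type) [Field K] [NumberField K] (h2 : Module.finrank ℚ K = 2)
  {θ : K} {c : ℚ} (hθ : θ ∉ Set.range (algebraMap ℚ K)) (hc : θ ^ 2 = algebraMap ℚ K c)
  (p : ℕ) [hp : Fact p.Prime]

include h2 hθ hc in
/-- **`#Ш(E_K)[p^∞] = #Ш(E)[p^∞] · #Ш(E^{(c)})[p^∞]` for every odd prime `p`, with NO finiteness hypothesis** (`Nat.card`; when a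
side is infinite both sides are `0`). The tree's `card_primaryComponent_sha_baseChange_quadratic_of_odd_of_finite` assumed the two
`ℚ`-side groups finite. Deliberate dot-notation extension of Mathlib's `WeierstrassCurve` namespace.
[cite: JetchevSkinnerWan2017, §7.4.1 (arXiv:1512.06894 p. 30)] [cite: DokchitserDokchitserAnnals2010, Lemma 4.14 (proof)] -/
theorem natCard_primaryComponent_sha_baseChange_quadratic_of_odd (hp2 : p ≠ 2) :
    Nat.card (AddCommGroup.primaryComponent (W.baseChange K).sha p) =
      Nat.card (AddCommGroup.primaryComponent W.sha p) *
        Nat.card (AddCommGroup.primaryComponent (W.quadraticTwist c).sha p) := by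
  haveI : (W.baseChange K).IsElliptic := by rw [baseChange]; infer_instance
  have hc0 : c ≠ 0 := by
    rintro rfl
    apply Quadratic.ne_zero_of_not_mem_range hθ
    have : θ ^ 2 = 0 := by rw [hc, map_zero]
    exact pow_eq_zero_iff (n := 2) (by norm_num) |>.mp this
  haveI : (W.quadraticTwist c).IsElliptic := W.isElliptic_quadraticTwist hc0
  obtain ⟨e⟩ := nonempty_addEquiv_primaryComponent_sha_prod_baseChange_of_odd W K h2 hθ hc p hp2
  rw [← Nat.card_congr e.toEquiv, Nat.card_prod]

include h2 hθ hc in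
/-- **`Ш(E_K)[p^∞]` is finite iff `Ш(E)[p^∞]` and `Ш(E^{(c)})[p^∞]` are** (odd `p`; the group-level form — for ALL `p` the
same equivalence holds by coranks, `finite_primaryComponent_sha_baseChange_iff_of_sq_eq`).
[cite: JetchevSkinnerWan2017, §7.4.1 (arXiv:1512.06894 p. 30)] -/
theorem finite_primaryComponent_sha_baseChange_iff_of_odd (hp2 : p ≠ 2) :
    Finite (AddCommGroup.primaryComponent (W.baseChange K).sha p) ↔
      Finite (AddCommGroup.primaryComponent W.sha p) ∧
        Finite (AddCommGroup.primaryComponent (W.quadraticTwist c).sha p) := by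
  haveI : (W.baseChange K).IsElliptic := by rw [baseChange]; infer_instance
  have hc0 : c ≠ 0 := by
    rintro rfl
    apply Quadratic.ne_zero_of_not_mem_range hθ
    have : θ ^ 2 = 0 := by rw [hc, map_zero]
    exact pow_eq_zero_iff (n := 2) (by norm_num) |>.mp this
  haveI : (W.quadraticTwist c).IsElliptic := W.isElliptic_quadraticTwist hc0
  obtain ⟨e⟩ := nonempty_addEquiv_primaryComponent_sha_prod_baseChange_of_odd W K h2 hθ hc p hp2
  rw [← Equiv.finite_iff e.toEquiv]
  constructor
  · intro h
    exact ⟨Finite.of_injective (fun a ↦ (a, (0 : AddCommGroup.primaryComponent (W.quadraticTwist c).sha p)))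
        fun a b hab ↦ (Prod.mk.inj hab).1,
      Finite.of_injective (fun b ↦ ((0 : AddCommGroup.primaryComponent W.sha p), b))
        fun a b hab ↦ (Prod.mk.inj hab).2⟩
  · rintro ⟨h1, h2'⟩
    infer_instance

/-- **Model-free form**: `#Ш(W'/K)[p^∞] = #Ш(E/ℚ)[p^∞] · #Ш(Wd/ℚ)[p^∞]` for every quadratic field `K`, every `ℚ`-model `Wd` of
`E^{(d_K)}`, every `K`-model `W'` of `E_K` and every odd prime `p` — the tree's
`card_primaryComponent_sha_baseChange_quadratic_of_odd_of_finite` WITHOUT its two `Finite` hypotheses.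
[cite: JetchevSkinnerWan2017, §7.4.1 (arXiv:1512.06894 p. 30)] [cite: DokchitserDokchitserAnnals2010, Lemma 4.14 (proof)] -/
theorem natCard_primaryComponent_sha_baseChange_quadratic_of_odd_of_variableChange (W : WeierstrassCurve ℚ)
    [W.IsElliptic] (K : Type) [Field K] [NumberField K] (h2 : Module.finrank ℚ K = 2)
    (Wd : WeierstrassCurve ℚ) (hWd : ∃ C : VariableChange ℚ, C • W.quadraticTwist (NumberField.discr K : ℚ) = Wd)
    (W' : WeierstrassCurve K) (hW' : ∃ C : VariableChange K, C • W.baseChange K = W')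
    (p : ℕ) [Fact p.Prime] (hp2 : p ≠ 2) :
    Nat.card (AddCommGroup.primaryComponent W'.sha p) =
      Nat.card (AddCommGroup.primaryComponent W.sha p) * Nat.card (AddCommGroup.primaryComponent Wd.sha p) := by
  obtain ⟨θ, c, hθ, hc⟩ := Quadratic.exists_sq_eq_algebraMap (F := ℚ) (K := K) h2
  obtain ⟨q, hq, hd⟩ := NumberField.exists_discr_eq_mul_sq h2 hθ hc
  obtain ⟨C₁, hC₁⟩ := W.exists_variableChange_quadraticTwist_mul_sq c q hq
  rw [← hd] at hC₁
  obtain ⟨Cd, hCd⟩ := hWd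
  obtain ⟨C', hC'⟩ := hW'
  subst hCd hC'
  rw [card_primaryComponent_sha_variableChange, card_primaryComponent_sha_variableChange, ← hC₁,
    card_primaryComponent_sha_variableChange]
  exact natCard_primaryComponent_sha_baseChange_quadratic_of_odd W K h2 hθ hc p hp2

end Orders

end WeierstrassCurve

end
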